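import Mathlib
import Literature.Analysis.Quadrature.ScrambledDigitalNetVariance
import Literature.Combinatorics.Enumerative.AntidiagonalTupleCard

/-!
# Scrambled nets: nested ANOVA terms and the improved rate for smooth integrands

[cite: DickPillichshammer2010, §13.2], [cite: DickPillichshammer2010, Cor. 13.21],
[cite: DickPillichshammer2010, Thm. 13.22], [cite: DickPillichshammer2010, Lemma 13.24],
[cite: DickPillichshammer2010, Thm. 13.25] (J. Dick, F. Pillichshammer, *Digital Nets and
Sequences*, CUP 2010, §13.2 and §13.5 "Improved rate of convergence for smooth functions").

Continuation of `ScrambledNetVariance` (Theorem 13.5), `ScrambledNetGainCoefficients`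
(Theorem 13.6 / Owen's gain coefficients) and `ScrambledDigitalNetVariance` (Theorem 13.9): those
files bound the variance of the randomised QMC estimator `Î(f)` over a scrambled `(t, m, s)`-net by
`(b^t / b^m) Σ_{|𝓵|₁ > m-t} σ_𝓵²(f)` (times `b^s` for general nets) for a Walsh polynomial `f`
with nested ANOVA variances `σ_𝓵²(f) = Σ_{𝐤 ∈ block 𝓵} |f̂(𝐤)|²`. This file supplies the other
half of §13.5 — the decay of `σ_ℓ²(f)` for smooth `f` — and the resulting rates.

## Contents

* §13.2 on the digit space: the Walsh coefficients `walshCoeffD` [eq. (13.4)]; the identity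
  `Σ_{k < b^w} f̂(k) wal_k(x) = b^w ∫_{⌊b^w y⌋ = ⌊b^w x⌋} f = E_w f(x)`
  (`sum_walshCoeffD_mul_walshD`: partial Walsh sums are the means over elementary intervals,
  i.e. conditional expectations given the first `w` digits); `β_w = E_w f - E_{w-1} f`
  (`nestedTerm_succ`); `σ_w²(f) = ∫ |β_w|²` [eq. (13.5)] (`integral_norm_sq_nestedTerm`); a
  function of finite precision `L` equals its Walsh polynomial of degree `< b^L`
  (`DependsOnDigits.walshPoly_walshCoeffD`).
* Corollary 13.21: a Hölder condition of order `0 < α ≤ 1` with constant `C_f` gives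
  `σ_ℓ²(f) ≤ C_f² (b-1)^{1+2α} b^{-2αℓ}` (`DigitHolderWith.blockVariance_le_rpow`). We prove it by
  the martingale route `σ_{w+1}² = ∫ |E_{w+1} f - E_w f|² ≤ ((b-1)/b · osc_w(f))²`
  (`blockVariance_walshCoeffD_succ_le`, where `osc_w(f)` bounds the oscillation of `f` on
  elementary intervals of order `w`), which yields the slightly sharper
  `σ_ℓ² ≤ ((b-1)/b)² C_f² b^{-2α(ℓ-1)}` (`DigitHolderWith.blockVariance_le`); the book argues via
  Fine's estimate (Theorem A.13) instead. Only `α ≤ 1` is used.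
* Theorem 13.22 (`IsDigitNet.integral_norm_sq_scrambledAverage_sub_le_of_holder`):
  `Var[Î(f)] ≤ b^{-(1+2α)(m-t)} C_f² (b-1)^{1+2α} / (b^{2α} - 1)` for a scrambled `(t, m, 1)`-net,
  from Theorem 13.5 and Corollary 13.21 by a geometric sum.
* Lemma 13.24 (`sum_pow_mul_choose_le`, `tsum_pow_mul_choose_le`), the stars-and-bars count
  `#{𝓵 : |𝓵|₁ = n} ≤ binom(n+s-1, s-1)` (`card_filter_sum_eq_le`), and the summation step of
  Theorem 13.25 in general geometric form: if `σ_𝓵²(f) ≤ K β^{|𝓵|₁}` (`0 ≤ β < 1`) then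
  `Σ_{|𝓵|₁ > n, 𝓵 ∈ [0,L]^s} σ_𝓵² ≤ K β^{n+1} binom(n+s, s-1) / (1-β)^s`
  (`sum_blockVariancePi_le_of_decay`), whence the variance bounds
  `IsDigitalTMSNet.integral_norm_sq_scrambledAveragePi_sub_le_of_decay` (digital nets, via
  Theorem 13.9) and `IsDigitNetPi.integral_norm_sq_scrambledAveragePi_sub_le_of_decay` (general
  `(t, m, s)`-nets, via Theorem 13.6 with Owen's gain bound).

## Modelling and referee notes

1. *Digit space.* As in the files above, `[0,1)` is replaced by the digit space `ℕ → Fin b` with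
   the uniform digit law `digitSeqMeasure b` (its image under `x = Σ ζ_i b^{-i}` is Lebesgue
   measure); elementary intervals become the cylinders `digitCylinder`. A Hölder function `F` on
   `[0,1]` is transported by `DigitHolderWith.comp_ofDigits` (two points of an elementary interval
   of order `w` are within `b^{-w}`).
2. *Finite precision in Theorem 13.22.* Theorem 13.5 in the tree is stated for Walsh polynomials,
   so Theorem 13.22 carries the hypothesis `DependsOnDigits b L f` — `f` has some finite precision
   `L`, arbitrary and absent from the bound. It therefore applies verbatim to
   `F ∘ ofDigits ∘ truncateDigits L`, i.e. to the estimator evaluated in `L`-digit arithmetic,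
   for every `L` (`IsDigitNet.integral_norm_sq_scrambledAverage_sub_le_of_holder_ofDigits`); the
   limit `L → ∞` for a general Hölder `f` (dominated convergence on both sides of the
   inequality) is routine and not carried out here.
3. *Theorem 13.25.* Its decay input `σ_𝓵²(f) ≤ (b-1)^{(2α-1)₊ s} b^{-2α|𝓵|₁} V_α(f)²` is
   Lemma 13.23 plus the Plancherel display on p. 430 (generalised Vitali variation of order `α`,
   `s`-dimensional); it is *not* formalised here and enters as the hypothesis
   `σ_𝓵² ≤ K β^{|𝓵|₁}` (`K = (b-1)^{(2α-1)₊ s} V_α²`, `β = b^{-2α}`), exactly as Theorem 13.9 in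
   the tree takes the Walsh coefficients as data. With `β = b^{-2α}` our conclusion reads
   `Var[Î(f)] ≤ K b^{-(1+2α)(m-t)} b^{s-2α} (1 - b^{-2α})^{-s} binom(m-t+s, s-1)`; the constant
   displayed in the book, `b^{2s} / (b^{2α} (b-1)^s)` in place of `b^{s-2α} (1-b^{-2α})^{-s}`,
   follows from `(1 - b^{-2α})^{-1} ≤ b/(b-1)`, which holds iff `α ≥ 1/2`: for `α < 1/2` the display
   on p. 431 is stronger than what its proof (Theorem 13.9 + Lemma 13.24) yields, so we keep the
   proof's form and do not assert the displayed constant.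
4. *Lemma 13.24* is stated in the book with binomials `binom(t+k-1, k-1)`, `k ≥ 1`; our `k` is
   the book's `k - 1` and the sum is re-indexed from `t₀`.
-/

open MeasureTheory Complex Finset
open scoped ENNReal ComplexConjugate

noncomputable section

namespace Literature.Analysis.Quadrature

variable (b : ℕ)

/-! ### Walsh coefficients, elementary cylinders and level means on the digit space -/

/-- The `k`-th **Walsh coefficient** `f̂(k) = ∫ f conj(ₖwal_b)` of a function on the digit space
`ℕ → Fin b` (uniform digit law `digitSeqMeasure b`) — the digit-space rendering of
`f̂(k) = ∫₀¹ f(x) conj(ₖwal_b(x)) dx`. [cite: DickPillichshammer2010, eq. (13.4)] -/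
def walshCoeffD [NeZero b] (f : (ℕ → Fin b) → ℂ) (k : ℕ) : ℂ :=
  ∫ η, f η * conj (walshD b k η) ∂digitSeqMeasure b

/-- The **elementary cylinder** of order `w` with digit string `e`: the digit sequences whose first
`w` digits are `e` (the `b`-adic elementary interval `[A b^{-w}, (A+1) b^{-w})`,
`A = e₁ b^{w-1} + ⋯ + e_w`, read on the digit space). [cite: DickPillichshammer2010, §13.2]
(p. 402: "the first `ℓ` digits of `x` and `y` coincide") -/
def digitCylinder (w : ℕ) (e : Fin w → Fin b) : Set (ℕ → Fin b) :=
  {ζ | digitsPrefix b w ζ = e}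

/-- The **cylinder mean** `b^w ∫_{[A b^{-w}, (A+1) b^{-w})} f` of `f` over the elementary cylinder
of order `w` with digits `e`. [cite: DickPillichshammer2010, §13.2] (p. 402, the display
`Σ_{k < b^ℓ} f̂(k) wal_k(x) = b^ℓ ∫_{⌊y b^ℓ⌋ = ⌊x b^ℓ⌋} f(y) dy`) -/
def cylinderMean [NeZero b] (w : ℕ) (e : Fin w → Fin b) (f : (ℕ → Fin b) → ℂ) : ℂ :=
  (b : ℂ) ^ w * ∫ ζ in digitCylinder b w e, f ζ ∂digitSeqMeasure b

/-- The **level-`w` mean** `x ↦ b^w ∫_{⌊y b^w⌋ = ⌊x b^w⌋} f(y) dy` (the conditional expectation of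
`f` given the first `w` digits). [cite: DickPillichshammer2010, §13.2] (p. 402) -/
def levelMean [NeZero b] (w : ℕ) (f : (ℕ → Fin b) → ℂ) (η : ℕ → Fin b) : ℂ :=
  cylinderMean b w (digitsPrefix b w η) f

/-- The **nested ANOVA term** `β_w(x) = Σ_{b^{w-1} ≤ k < b^w} f̂(k) wal_k(x)` (`w ≥ 1`; for `w = 0`
the block is empty and the value is `0`, matching `blockVariance`).
[cite: DickPillichshammer2010, §13.2] (p. 402, definition of `β_ℓ`) -/
def nestedTerm [NeZero b] (w : ℕ) (f : (ℕ → Fin b) → ℂ) (η : ℕ → Fin b) : ℂ :=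
  ∑ k ∈ Ico (b ^ (w - 1)) (b ^ w), walshCoeffD b f k * walshD b k η

/-- `f` **depends only on the first `L` digits** (is constant on the elementary intervals of order
`L`; e.g. a Walsh polynomial of degree `< b^L` [cite: DickPillichshammer2010, Prop. A.2], or an
integrand evaluated at points truncated to `L` digits). -/
def DependsOnDigits (L : ℕ) (f : (ℕ → Fin b) → ℂ) : Prop :=
  ∀ ⦃η η' : ℕ → Fin b⦄, digitsPrefix b L η = digitsPrefix b L η' → f η = f η'

/-- **Digit-space Hölder condition** with constant `C` and ratio `q`: `|f(ζ) - f(ζ')| ≤ C q^w`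
whenever `ζ, ζ'` share their first `w` digits. For `f = F ∘ (digit expansion)` with
`|F(x) - F(y)| ≤ C |x - y|^α` on `[0,1]` this holds with `q = b^{-α}`
(`DigitHolderWith.comp_ofDigits`), since two points of a common elementary interval of order `w`
are within `b^{-w}`. [cite: DickPillichshammer2010, Cor. 13.21] (hypothesis: "a Hölder condition
of order `0 < α ≤ 1`", p. 425) -/
def DigitHolderWith (C q : ℝ) (f : (ℕ → Fin b) → ℂ) : Prop :=
  ∀ (w : ℕ) (ζ ζ' : ℕ → Fin b), digitsPrefix b w ζ = digitsPrefix b w ζ' → ‖f ζ - f ζ'‖ ≤ C * q ^ w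

/-- Zero-padding of a finite digit string to a digit sequence. [folklore] -/
def padDigits [NeZero b] {L : ℕ} (e : Fin L → Fin b) : ℕ → Fin b :=
  fun i => if h : i < L then e ⟨i, h⟩ else 0

/-- Truncation of a digit sequence after `L` digits (the point `⌊b^L x⌋ b^{-L}`). [folklore] -/
def truncateDigits [NeZero b] (L : ℕ) (ζ : ℕ → Fin b) : ℕ → Fin b :=
  fun i => if i < L then ζ i else 0

variable {b}

/-! ### Cylinders: measurability, mass, refinement -/

/-- Taking the first `w` digits is measurable. [folklore] -/
private theorem measurable_digitsPrefix' (w : ℕ) : Measurable (digitsPrefix b w) :=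
  measurable_pi_lambda _ fun i => measurable_pi_apply (i : ℕ)

/-- Membership in a cylinder is a prefix condition. [folklore] -/
@[simp] private theorem mem_digitCylinder {w : ℕ} {e : Fin w → Fin b} {ζ : ℕ → Fin b} :
    ζ ∈ digitCylinder b w e ↔ digitsPrefix b w ζ = e := Iff.rfl

/-- Cylinders are measurable. [folklore] -/
private theorem measurableSet_digitCylinder (w : ℕ) (e : Fin w → Fin b) :
    MeasurableSet (digitCylinder b w e) :=
  (measurable_digitsPrefix' w) (measurableSet_singleton e)

/-- An elementary interval of order `w` has volume `b^{-w}`.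
[cite: DickPillichshammer2010, Thm. A.11] (proof, p. 549: "`λ_s(x ⊖ [0, b^{-n})^s) = b^{-ns}`";
here `s = 1`, on the digit space) -/
theorem digitSeqMeasure_digitCylinder [NeZero b] (w : ℕ) (e : Fin w → Fin b) :
    digitSeqMeasure b (digitCylinder b w e) = ((b : ℝ≥0∞)⁻¹) ^ w := by
  classical
  have hset : digitCylinder b w e =
      Set.pi (↑(Finset.range w)) fun i => ({padDigits b e i} : Set (Fin b)) := by
    ext ζ
    simp only [mem_digitCylinder, Set.mem_pi, Finset.coe_range, Set.mem_Iio,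
      Set.mem_singleton_iff]
    constructor
    · rintro rfl i hi
      simp [digitsPrefix, padDigits, hi]
    · intro h
      funext i
      have := h i i.isLt
      simpa [digitsPrefix, padDigits, i.isLt] using this
  rw [hset, digitSeqMeasure, Measure.infinitePi_pi _ (fun i _ => measurableSet_singleton _)]
  simp only [digitMeasure, Measure.smul_apply, smul_eq_mul, Measure.count_singleton, mul_one,
    Finset.prod_const, Finset.card_range]

/-- An elementary interval of order `w` has volume `b^{-w}` (real form).
[cite: DickPillichshammer2010, Thm. A.11] (proof, p. 549: "`λ_s(x ⊖ [0, b^{-n})^s) = b^{-ns}`") -/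
theorem measureReal_digitCylinder [NeZero b] (w : ℕ) (e : Fin w → Fin b) :
    (digitSeqMeasure b).real (digitCylinder b w e) = ((b : ℝ) ^ w)⁻¹ := by
  rw [measureReal_def, digitSeqMeasure_digitCylinder, ENNReal.toReal_pow, ENNReal.toReal_inv,
    ENNReal.toReal_natCast, inv_pow]

/-- The cylinder of order `0` is everything. [folklore] -/
@[simp] private theorem digitCylinder_zero (e : Fin 0 → Fin b) : digitCylinder b 0 e = Set.univ :=
  Set.eq_univ_of_forall fun _ => Subsingleton.elim _ _

/-- The first `w + 1` digits are the first `w` digits followed by digit `w`. [folklore] -/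
private theorem digitsPrefix_succ (w : ℕ) (η : ℕ → Fin b) :
    digitsPrefix b (w + 1) η = Fin.snoc (digitsPrefix b w η) (η w) := by
  funext i
  refine Fin.lastCases ?_ (fun j => ?_) i
  · simp [digitsPrefix, Fin.snoc_last]
  · simp [digitsPrefix, Fin.snoc_castSucc]

/-- Membership in a child cylinder. [folklore] -/
private theorem mem_digitCylinder_snoc {w : ℕ} {e : Fin w → Fin b} {d : Fin b} {ζ : ℕ → Fin b} :
    ζ ∈ digitCylinder b (w + 1) (Fin.snoc e d) ↔ digitsPrefix b w ζ = e ∧ ζ w = d := by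
  rw [mem_digitCylinder, digitsPrefix_succ, Fin.snoc_inj]

/-- An elementary interval of order `w` is the disjoint union of its `b` children of order
`w + 1`. [folklore] -/
private theorem digitCylinder_eq_iUnion (w : ℕ) (e : Fin w → Fin b) :
    digitCylinder b w e = ⋃ d : Fin b, digitCylinder b (w + 1) (Fin.snoc e d) := by
  ext ζ
  rw [Set.mem_iUnion]
  exact ⟨fun h => ⟨ζ w, mem_digitCylinder_snoc.2 ⟨h, rfl⟩⟩,
    fun ⟨_, hd⟩ => (mem_digitCylinder_snoc.1 hd).1⟩

/-- Distinct children are disjoint. [folklore] -/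
private theorem pairwise_disjoint_digitCylinder_snoc (w : ℕ) (e : Fin w → Fin b) :
    Pairwise (Function.onFun Disjoint fun d : Fin b => digitCylinder b (w + 1) (Fin.snoc e d)) :=
  fun _ _ hne => Set.disjoint_left.2 fun _ h h' =>
    hne ((mem_digitCylinder_snoc.1 h).2.symm.trans (mem_digitCylinder_snoc.1 h').2)

/-! ### Walsh coefficients: partial sums are level means -/

/-- `f conj(wal_k)` is integrable for integrable `f` (`|wal_k| = 1`). [folklore] -/
private theorem integrable_mul_conj_walshD [NeZero b] {f : (ℕ → Fin b) → ℂ}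
    (hf : Integrable f (digitSeqMeasure b)) (k : ℕ) :
    Integrable (fun η => f η * conj (walshD b k η)) (digitSeqMeasure b) :=
  hf.mul_bdd (Complex.continuous_conj.measurable.comp (measurable_walshD k)).aestronglyMeasurable
    (ae_of_all _ fun η => by rw [Complex.norm_conj, norm_walshD])

/-- `wal_k conj(wal_l)` is integrable on the digit space. [folklore] -/
private theorem integrable_walshD_mul_conj_walshD [NeZero b] (k l : ℕ) :
    Integrable (fun η => walshD b k η * conj (walshD b l η)) (digitSeqMeasure b) :=
  (integrable_const (1 : ℝ)).mono'
    ((measurable_walshD k).mul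
      (Complex.continuous_conj.measurable.comp (measurable_walshD l))).aestronglyMeasurable
    (ae_of_all _ fun η => by rw [norm_mul, Complex.norm_conj, norm_walshD, norm_walshD, mul_one])

/-- `f̂(0) = ∫ f` (`wal_0 ≡ 1`). [cite: DickPillichshammer2010, §13.2] (`β_0 := ∫₀¹ f(y) dy`,
p. 402) -/
@[simp] theorem walshCoeffD_zero_eq_integral [NeZero b] (f : (ℕ → Fin b) → ℂ) :
    walshCoeffD b f 0 = ∫ η, f η ∂digitSeqMeasure b := by
  simp [walshCoeffD]

/-- **Partial Walsh sums are level means**: for integrable `f` on the digit space and `b ≥ 2`,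
`Σ_{k=0}^{b^w - 1} f̂(k) wal_k(x) = b^w ∫_{⌊y b^w⌋ = ⌊x b^w⌋} f(y) dy` — by the Walsh–Dirichlet
kernel `D_w = Σ_{k < b^w} wal_k = b^w χ_{[0, b^{-w})}` [cite: DickPillichshammer2010, Lemma A.17].
[cite: DickPillichshammer2010, §13.2] (the display following (13.4), p. 402; also the first
display of the proof of Lemma 13.23, p. 427) -/
theorem sum_walshCoeffD_mul_walshD [NeZero b] (hb : 1 < b) {f : (ℕ → Fin b) → ℂ}
    (hf : Integrable f (digitSeqMeasure b)) (w : ℕ) (η : ℕ → Fin b) :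
    ∑ k ∈ range (b ^ w), walshCoeffD b f k * walshD b k η = levelMean b w f η := by
  have hint : ∀ k, Integrable (fun ζ => f ζ * (walshD b k η * conj (walshD b k ζ)))
      (digitSeqMeasure b) := by
    intro k
    have h := (integrable_mul_conj_walshD hf k).mul_const (walshD b k η)
    refine h.congr (ae_of_all _ fun ζ => ?_)
    simp only
    ring
  calc ∑ k ∈ range (b ^ w), walshCoeffD b f k * walshD b k η
      = ∑ k ∈ range (b ^ w), ∫ ζ, f ζ * (walshD b k η * conj (walshD b k ζ))
          ∂digitSeqMeasure b := by
        refine sum_congr rfl fun k _ => ?_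
        rw [walshCoeffD, ← integral_mul_const]
        exact integral_congr_ae (ae_of_all _ fun ζ => by simp only; ring)
    _ = ∫ ζ, ∑ k ∈ range (b ^ w), f ζ * (walshD b k η * conj (walshD b k ζ))
          ∂digitSeqMeasure b := (integral_finsetSum _ fun k _ => hint k).symm
    _ = ∫ ζ, (digitCylinder b w (digitsPrefix b w η)).indicator (fun ζ => (b : ℂ) ^ w * f ζ) ζ
          ∂digitSeqMeasure b := by
        refine integral_congr_ae (ae_of_all _ fun ζ => ?_)
        simp only
        rw [← mul_sum, sum_walshD_mul_conj_walshD_eq hb w η ζ]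
        unfold prefixInd
        by_cases h : digitsPrefix b w η = digitsPrefix b w ζ
        · rw [if_pos h, Set.indicator_of_mem (show ζ ∈ digitCylinder b w (digitsPrefix b w η)
            from h.symm)]
          push_cast
          ring
        · have hζ : ζ ∉ digitCylinder b w (digitsPrefix b w η) := fun h' => h (Eq.symm h')
          rw [if_neg h, Set.indicator_of_notMem hζ]
          push_cast
          ring
    _ = levelMean b w f η := by
        rw [integral_indicator (measurableSet_digitCylinder _ _), integral_const_mul]
        rfl

/-- The level-`0` mean is the integral. [folklore] -/
@[simp] private theorem levelMean_zero [NeZero b] (f : (ℕ → Fin b) → ℂ) (η : ℕ → Fin b) :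
    levelMean b 0 f η = ∫ ζ, f ζ ∂digitSeqMeasure b := by
  simp [levelMean, cylinderMean, Measure.restrict_univ]

/-- **`β_w = E_w - E_{w-1}`**: for `w ≥ 1`,
`β_w(x) = b^w ∫_{⌊y b^w⌋ = ⌊x b^w⌋} f(y) dy - b^{w-1} ∫_{⌊y b^{w-1}⌋ = ⌊x b^{w-1}⌋} f(y) dy`.
[cite: DickPillichshammer2010, §13.2] (p. 402, the display defining `β_ℓ`) -/
theorem nestedTerm_succ [NeZero b] (hb : 1 < b) {f : (ℕ → Fin b) → ℂ}
    (hf : Integrable f (digitSeqMeasure b)) (w : ℕ) (η : ℕ → Fin b) :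
    nestedTerm b (w + 1) f η = levelMean b (w + 1) f η - levelMean b w f η := by
  have hle : b ^ w ≤ b ^ (w + 1) := Nat.pow_le_pow_right (by omega) (Nat.le_succ w)
  rw [nestedTerm, Nat.add_sub_cancel, ← sum_walshCoeffD_mul_walshD hb hf (w + 1) η,
    ← sum_walshCoeffD_mul_walshD hb hf w η, Finset.range_eq_Ico, Finset.range_eq_Ico,
    ← Finset.sum_Ico_consecutive _ (Nat.zero_le (b ^ w)) hle, add_sub_cancel_left]

/-! ### Functions of finite precision -/

namespace DependsOnDigits

variable {L : ℕ} {f : (ℕ → Fin b) → ℂ}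

/-- Precision `L` implies precision `w` for `w ≥ L`. [folklore] -/
private theorem mono (hf : DependsOnDigits b L f) {w : ℕ} (hLw : L ≤ w) : DependsOnDigits b w f :=
  fun _ _ h => hf (funext fun i => congrFun h ⟨i, lt_of_lt_of_le i.isLt hLw⟩)

variable [NeZero b]

/-- Padding then truncating recovers the digit string. [folklore] -/
private theorem digitsPrefix_padDigits (e : Fin L → Fin b) :
    digitsPrefix b L (padDigits b e) = e := by
  funext i
  simp [digitsPrefix, padDigits, i.isLt]

/-- A function of precision `L` factors through the first `L` digits. [folklore] -/
private theorem eq_comp (hf : DependsOnDigits b L f) :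
    f = (fun e : Fin L → Fin b => f (padDigits b e)) ∘ digitsPrefix b L :=
  funext fun η => hf (digitsPrefix_padDigits (digitsPrefix b L η)).symm

/-- A function of finite precision is measurable. [folklore] -/
private theorem measurable (hf : DependsOnDigits b L f) : Measurable f := by
  rw [hf.eq_comp]
  exact (measurable_of_countable _).comp (measurable_digitsPrefix' L)

/-- A function of finite precision is bounded. [folklore] -/
private theorem norm_le (hf : DependsOnDigits b L f) (η : ℕ → Fin b) :
    ‖f η‖ ≤ ∑ e : Fin L → Fin b, ‖f (padDigits b e)‖ := by
  rw [hf (digitsPrefix_padDigits (digitsPrefix b L η)).symm]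
  exact Finset.single_le_sum (f := fun e => ‖f (padDigits b e)‖) (fun _ _ => norm_nonneg _)
    (mem_univ (digitsPrefix b L η))

/-- A function of finite precision is integrable. [folklore] -/
private theorem integrable (hf : DependsOnDigits b L f) : Integrable f (digitSeqMeasure b) :=
  (integrable_const _).mono' hf.measurable.aestronglyMeasurable (ae_of_all _ hf.norm_le)

/-- Beyond its precision a function equals its level means: `E_w f = S_{b^w}(·, f) = f` for
`w ≥ L` (the oscillation of `f` on elementary intervals of order `w` vanishes).
[cite: DickPillichshammer2010, Thm. A.11] (proof, p. 549:
`|S_{b_n}(x, f) - f(x)| ≤ sup{|f(t) - f(x)| : t ∈ x ⊖ [0, b^{-n})^s}`) -/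
theorem levelMean_eq (hf : DependsOnDigits b L f) {w : ℕ} (hLw : L ≤ w) (η : ℕ → Fin b) :
    levelMean b w f η = f η := by
  have hB : (b : ℂ) ^ w ≠ 0 := pow_ne_zero _ (Nat.cast_ne_zero.2 (NeZero.ne b))
  have hEq : Set.EqOn f (fun _ => f η) (digitCylinder b w (digitsPrefix b w η)) :=
    fun ζ hζ => hf.mono hLw (mem_digitCylinder.1 hζ)
  rw [levelMean, cylinderMean, setIntegral_congr_fun (measurableSet_digitCylinder _ _) hEq,
    setIntegral_const, measureReal_digitCylinder, Complex.real_smul]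
  push_cast
  rw [← mul_assoc, mul_inv_cancel₀ hB, one_mul]

/-- **Walsh expansion of a function of finite precision**: if `f` depends only on the first `L`
digits then `f = Σ_{k < b^L} f̂(k) wal_k` exactly (a Walsh polynomial of degree `< b^L`).
[cite: DickPillichshammer2010, Lemma A.17] (via the partial-sum formula of §13.2, p. 402; cf.
Prop. A.2: Walsh functions are step functions on elementary intervals) -/
theorem walshPoly_walshCoeffD (hb : 1 < b) (hf : DependsOnDigits b L f) (η : ℕ → Fin b) :
    walshPoly b L (walshCoeffD b f) η = f η := by
  rw [walshPoly, sum_walshCoeffD_mul_walshD hb hf.integrable L η, hf.levelMean_eq le_rfl]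

/-- … hence all Walsh coefficients of wavenumber `≥ b^L` of a function of precision `L` vanish:
`f̂(k) = 0` for `k ≥ b^L` (from `f = Σ_{l < b^L} f̂(l) wal_l` and the orthonormality of the Walsh
system [cite: DickPillichshammer2010, Prop. A.10]; cf. [cite: DickPillichshammer2010, Prop. A.2]).
-/
theorem walshCoeffD_eq_zero (hb : 1 < b) (hf : DependsOnDigits b L f) {k : ℕ} (hk : b ^ L ≤ k) :
    walshCoeffD b f k = 0 := by
  have hfW : f = walshPoly b L (walshCoeffD b f) :=
    funext fun η => (hf.walshPoly_walshCoeffD hb η).symm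
  set c := walshCoeffD b f with hc
  have hI : ∀ l, Integrable (fun η => c l * (walshD b l η * conj (walshD b k η)))
      (digitSeqMeasure b) := fun l => (integrable_walshD_mul_conj_walshD l k).const_mul _
  have hexp : ∀ η, walshPoly b L c η * conj (walshD b k η) =
      ∑ l ∈ range (b ^ L), c l * (walshD b l η * conj (walshD b k η)) := by
    intro η
    rw [walshPoly, sum_mul]
    exact sum_congr rfl fun l _ => by ring
  rw [hc, walshCoeffD, hfW]
  simp_rw [hexp]
  rw [integral_finsetSum _ fun l _ => hI l]
  refine sum_eq_zero fun l hl => ?_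
  rw [integral_const_mul, integral_walshD_mul_conj_walshD hb,
    if_neg (by have := mem_range.1 hl; omega), mul_zero]

end DependsOnDigits

/-- Truncation to `L` digits produces a function of precision `L`. [folklore] -/
private theorem dependsOnDigits_comp_truncateDigits [NeZero b] (L : ℕ) (g : (ℕ → Fin b) → ℂ) :
    DependsOnDigits b L (fun ζ => g (truncateDigits b L ζ)) := by
  intro η η' h
  have : truncateDigits b L η = truncateDigits b L η' := by
    funext i
    by_cases hi : i < L
    · simpa [truncateDigits, digitsPrefix, hi] using congrFun h ⟨i, hi⟩
    · simp [truncateDigits, hi]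
  simp only [this]

/-! ### The martingale structure: `σ_w² = ∫ |β_w|²` and the oscillation bound -/

/-- `∫ |Σ_{k ∈ S} c_k wal_k|² = Σ_{k ∈ S} |c_k|²` on the digit space (orthonormality of the Walsh
system [cite: DickPillichshammer2010, Prop. A.10]). -/
private theorem integral_norm_sq_sum_mul_walshD [NeZero b] (hb : 1 < b) (S : Finset ℕ) (c : ℕ → ℂ) :
    ∫ η, ‖∑ k ∈ S, c k * walshD b k η‖ ^ 2 ∂digitSeqMeasure b = ∑ k ∈ S, ‖c k‖ ^ 2 := by
  have hI : ∀ k l, Integrable (fun η => c k * conj (c l) * (walshD b k η * conj (walshD b l η)))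
      (digitSeqMeasure b) := fun k l => (integrable_walshD_mul_conj_walshD k l).const_mul _
  have hexp : ∀ η, (∑ k ∈ S, c k * walshD b k η) * conj (∑ k ∈ S, c k * walshD b k η) =
      ∑ k ∈ S, ∑ l ∈ S, c k * conj (c l) * (walshD b k η * conj (walshD b l η)) := by
    intro η
    rw [map_sum, sum_mul_sum]
    refine sum_congr rfl fun k _ => sum_congr rfl fun l _ => ?_
    rw [map_mul]
    ring
  have key : (((∫ η, ‖∑ k ∈ S, c k * walshD b k η‖ ^ 2 ∂digitSeqMeasure b : ℝ)) : ℂ) =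
      ∑ k ∈ S, (((‖c k‖ ^ 2 : ℝ)) : ℂ) := by
    rw [← integral_complex_ofReal]
    push_cast
    simp_rw [← Complex.mul_conj', hexp]
    rw [integral_finsetSum _ fun k _ => integrable_finsetSum _ fun l _ => hI k l]
    refine sum_congr rfl fun k hk => ?_
    rw [integral_finsetSum _ fun l _ => hI k l]
    simp_rw [integral_const_mul, integral_walshD_mul_conj_walshD hb, mul_ite, mul_one, mul_zero]
    rw [Finset.sum_ite_eq, if_pos hk, Complex.mul_conj']
  exact_mod_cast key

/-- **`σ_w²(f) = ∫₀¹ |β_w(x)|² dx`** (orthogonality of the Walsh functions).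
[cite: DickPillichshammer2010, eq. (13.5)] (and the display following it, p. 402) -/
theorem integral_norm_sq_nestedTerm [NeZero b] (hb : 1 < b) (f : (ℕ → Fin b) → ℂ) (w : ℕ) :
    ∫ η, ‖nestedTerm b w f η‖ ^ 2 ∂digitSeqMeasure b = blockVariance b (walshCoeffD b f) w :=
  integral_norm_sq_sum_mul_walshD hb _ _

/-- **Refinement of cylinder means**: the mean over an elementary interval of order `w` is the
average of the means over its `b` children. [folklore] (the tower property of conditional
expectations along the digit filtration) -/
private theorem cylinderMean_eq_sum [NeZero b] {f : (ℕ → Fin b) → ℂ}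
    (hf : Integrable f (digitSeqMeasure b)) (w : ℕ) (e : Fin w → Fin b) :
    cylinderMean b w e f = (b : ℂ)⁻¹ * ∑ d : Fin b, cylinderMean b (w + 1) (Fin.snoc e d) f := by
  have hb0 : (b : ℂ) ≠ 0 := Nat.cast_ne_zero.2 (NeZero.ne b)
  unfold cylinderMean
  rw [digitCylinder_eq_iUnion, integral_iUnion_fintype (fun d => measurableSet_digitCylinder _ _)
    (pairwise_disjoint_digitCylinder_snoc w e) (fun d => hf.integrableOn), mul_sum, mul_sum]
  refine sum_congr rfl fun d _ => ?_
  rw [pow_succ]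
  field_simp

/-- The mean of `f` over an elementary interval is within `ω` of any value that `f` stays within
`ω` of on that interval: `|b^n ∫_I f - c| = b^n |∫_I (f - c)| ≤ sup_I |f - c| · b^n λ(I)`.
[cite: DickPillichshammer2010, Thm. A.11] (proof, p. 549: the display
`|S_{b_n}(x, f) - f(x)| = b^{ns} |∫_{x ⊖ [0,b^{-n})^s} (f(t) - f(x)) dt| ≤ sup{|f(t) - f(x)| : …}
b^{ns} λ_s(x ⊖ [0, b^{-n})^s)`) -/
theorem norm_cylinderMean_sub_le [NeZero b] {f : (ℕ → Fin b) → ℂ} {w : ℕ} {e : Fin w → Fin b}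
    (hf : IntegrableOn f (digitCylinder b w e) (digitSeqMeasure b)) {c : ℂ} {ω : ℝ}
    (h : ∀ ζ ∈ digitCylinder b w e, ‖f ζ - c‖ ≤ ω) : ‖cylinderMean b w e f - c‖ ≤ ω := by
  have hB : (b : ℝ) ^ w ≠ 0 := pow_ne_zero _ (Nat.cast_ne_zero.2 (NeZero.ne b))
  have hBC : (b : ℂ) ^ w ≠ 0 := pow_ne_zero _ (Nat.cast_ne_zero.2 (NeZero.ne b))
  have hμ := measureReal_digitCylinder (b := b) w e
  have hC : cylinderMean b w e f - c =
      (b : ℂ) ^ w * ∫ ζ in digitCylinder b w e, (f ζ - c) ∂digitSeqMeasure b := by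
    rw [integral_sub hf (integrable_const c), setIntegral_const c, hμ, cylinderMean,
      Complex.real_smul, mul_sub]
    push_cast
    rw [← mul_assoc, mul_inv_cancel₀ hBC, one_mul]
  rw [hC, norm_mul, norm_pow, Complex.norm_natCast]
  calc (b : ℝ) ^ w * ‖∫ ζ in digitCylinder b w e, (f ζ - c) ∂digitSeqMeasure b‖
      ≤ (b : ℝ) ^ w * (ω * (digitSeqMeasure b).real (digitCylinder b w e)) :=
        mul_le_mul_of_nonneg_left
          (norm_setIntegral_le_of_norm_le_const (measure_lt_top _ _) h) (by positivity)
    _ = ω := by rw [hμ]; field_simp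

/-- The means of `f` over two children of the same elementary interval differ by at most the
oscillation of `f` on the parent. [folklore] -/
private theorem norm_cylinderMean_snoc_sub_le [NeZero b] {f : (ℕ → Fin b) → ℂ}
    (hf : Integrable f (digitSeqMeasure b)) (w : ℕ) (e : Fin w → Fin b) {ω : ℝ}
    (hω : ∀ ζ ζ', digitsPrefix b w ζ = e → digitsPrefix b w ζ' = e → ‖f ζ - f ζ'‖ ≤ ω)
    (d d' : Fin b) :
    ‖cylinderMean b (w + 1) (Fin.snoc e d) f - cylinderMean b (w + 1) (Fin.snoc e d') f‖ ≤ ω := by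
  refine norm_cylinderMean_sub_le hf.integrableOn fun ζ hζ => ?_
  rw [← norm_sub_rev]
  exact norm_cylinderMean_sub_le hf.integrableOn fun ζ' hζ' =>
    hω ζ' ζ (mem_digitCylinder_snoc.1 hζ').1 (mem_digitCylinder_snoc.1 hζ).1

/-- **Oscillation bound for the martingale increments**: if `f` oscillates by at most `ω` on every
elementary interval of order `w`, then `|E_{w+1} f - E_w f| ≤ ((b-1)/b) ω` pointwise.
[folklore] (the step behind [cite: DickPillichshammer2010, Cor. 13.21]) -/
theorem norm_levelMean_succ_sub_le [NeZero b] {f : (ℕ → Fin b) → ℂ}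
    (hf : Integrable f (digitSeqMeasure b)) (w : ℕ) {ω : ℝ}
    (hω : ∀ ζ ζ', digitsPrefix b w ζ = digitsPrefix b w ζ' → ‖f ζ - f ζ'‖ ≤ ω) (η : ℕ → Fin b) :
    ‖levelMean b (w + 1) f η - levelMean b w f η‖ ≤ ((b : ℝ) - 1) / b * ω := by
  have hb0 : (b : ℂ) ≠ 0 := Nat.cast_ne_zero.2 (NeZero.ne b)
  have hb1 : 1 ≤ b := Nat.one_le_iff_ne_zero.2 (NeZero.ne b)
  set e := digitsPrefix b w η with he
  set g : Fin b → ℂ := fun d => cylinderMean b (w + 1) (Fin.snoc e d) f with hg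
  have hE1 : levelMean b (w + 1) f η = g (η w) := by
    simp only [levelMean, hg, he, digitsPrefix_succ]
  have hE0 : levelMean b w f η = (b : ℂ)⁻¹ * ∑ d, g d := cylinderMean_eq_sum hf w e
  have hdiff : levelMean b (w + 1) f η - levelMean b w f η = (b : ℂ)⁻¹ * ∑ d, (g (η w) - g d) := by
    rw [hE1, hE0, Finset.sum_sub_distrib, sum_const, card_univ, Fintype.card_fin, nsmul_eq_mul,
      mul_sub, ← mul_assoc, inv_mul_cancel₀ hb0, one_mul]
  have hgd : ∀ d, ‖g (η w) - g d‖ ≤ ω := fun d =>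
    norm_cylinderMean_snoc_sub_le hf w e (fun ζ ζ' h h' => hω ζ ζ' (h.trans h'.symm)) _ _
  have hsum : ‖∑ d, (g (η w) - g d)‖ ≤ ((b : ℝ) - 1) * ω := by
    rw [← Finset.add_sum_erase _ _ (mem_univ (η w)), sub_self, zero_add]
    calc ‖∑ d ∈ univ.erase (η w), (g (η w) - g d)‖
        ≤ ∑ d ∈ univ.erase (η w), ‖g (η w) - g d‖ := norm_sum_le _ _
      _ ≤ ∑ d ∈ univ.erase (η w), ω := sum_le_sum fun d _ => hgd d
      _ = ((b : ℝ) - 1) * ω := by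
        rw [sum_const, card_erase_of_mem (mem_univ _), card_univ, Fintype.card_fin, nsmul_eq_mul,
          Nat.cast_sub hb1, Nat.cast_one]
  rw [hdiff, norm_mul, norm_inv, Complex.norm_natCast]
  calc (b : ℝ)⁻¹ * ‖∑ d, (g (η w) - g d)‖ ≤ (b : ℝ)⁻¹ * (((b : ℝ) - 1) * ω) :=
        mul_le_mul_of_nonneg_left hsum (by positivity)
    _ = ((b : ℝ) - 1) / b * ω := by ring

/-- **`σ_{w+1}²(f) ≤ ((b-1)/b · ω_w)²`** when `f` oscillates by at most `ω_w` on the elementary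
intervals of order `w` (from `σ_{w+1}² = ∫ |E_{w+1} f - E_w f|²`). [folklore] (the step behind
[cite: DickPillichshammer2010, Cor. 13.21]; cf. the bound `σ_ℓ²(f) ≤ (b-1) M_{f,2}²((b-1) b^{-ℓ})`
displayed on p. 425) -/
theorem blockVariance_walshCoeffD_succ_le [NeZero b] (hb : 1 < b) {f : (ℕ → Fin b) → ℂ}
    (hf : Integrable f (digitSeqMeasure b)) (w : ℕ) {ω : ℝ}
    (hω : ∀ ζ ζ', digitsPrefix b w ζ = digitsPrefix b w ζ' → ‖f ζ - f ζ'‖ ≤ ω) :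
    blockVariance b (walshCoeffD b f) (w + 1) ≤ (((b : ℝ) - 1) / b * ω) ^ 2 := by
  rw [← integral_norm_sq_nestedTerm hb f (w + 1)]
  have hpt : ∀ η, ‖nestedTerm b (w + 1) f η‖ ^ 2 ≤ (((b : ℝ) - 1) / b * ω) ^ 2 := fun η => by
    rw [nestedTerm_succ hb hf]
    exact pow_le_pow_left₀ (norm_nonneg _) (norm_levelMean_succ_sub_le hf w hω η) 2
  calc ∫ η, ‖nestedTerm b (w + 1) f η‖ ^ 2 ∂digitSeqMeasure b
      ≤ ∫ _, (((b : ℝ) - 1) / b * ω) ^ 2 ∂digitSeqMeasure b :=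
        integral_mono_of_nonneg (ae_of_all _ fun η => by positivity) (integrable_const _)
          (ae_of_all _ hpt)
    _ = (((b : ℝ) - 1) / b * ω) ^ 2 := by simp

/-! ### Corollary 13.21 and Theorem 13.22 -/

namespace DigitHolderWith

variable [NeZero b] {C q : ℝ} {f : (ℕ → Fin b) → ℂ}

/-- **Decay of the nested ANOVA variances of a digit-Hölder function**: if
`|f(ζ) - f(ζ')| ≤ C q^w` whenever `ζ, ζ'` share `w` digits, then
`σ_ℓ²(f) ≤ ((b-1)/b)² C² q^{2(ℓ-1)}` for `ℓ ≥ 1`. [folklore] (martingale form of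
[cite: DickPillichshammer2010, Cor. 13.21]) -/
theorem blockVariance_le (hb : 1 < b) (hF : DigitHolderWith b C q f)
    (hf : Integrable f (digitSeqMeasure b)) {ℓ : ℕ} (hℓ : 1 ≤ ℓ) :
    blockVariance b (walshCoeffD b f) ℓ ≤ (((b : ℝ) - 1) / b * (C * q ^ (ℓ - 1))) ^ 2 := by
  obtain ⟨w, rfl⟩ := Nat.exists_eq_add_of_le' hℓ
  rw [Nat.add_sub_cancel]
  exact blockVariance_walshCoeffD_succ_le hb hf w (hF w)

/-- **Corollary 13.21** [cite: DickPillichshammer2010, Cor. 13.21]: if `f` satisfies a Hölder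
condition of order `0 < α ≤ 1` with constant `C_f` — on the digit space: `|f(ζ) - f(ζ')| ≤ C_f
b^{-αw}` whenever `ζ, ζ'` share `w` digits — then for every `ℓ ∈ ℕ`,
`σ_ℓ²(f) ≤ C_f² (b-1)^{1+2α} b^{-2αℓ}` (we prove the sharper `((b-1)/b)² C_f² b^{-2α(ℓ-1)}` in
`DigitHolderWith.blockVariance_le`; only `α ≤ 1` is used). -/
theorem blockVariance_le_rpow (hb : 1 < b) {α : ℝ} (hα₁ : α ≤ 1)
    (hF : DigitHolderWith b C ((b : ℝ) ^ (-α)) f) (hf : Integrable f (digitSeqMeasure b))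
    {ℓ : ℕ} (hℓ : 1 ≤ ℓ) :
    blockVariance b (walshCoeffD b f) ℓ ≤
      C ^ 2 * ((b : ℝ) - 1) ^ (1 + 2 * α) * (b : ℝ) ^ (-(2 * α * ℓ)) := by
  refine (hF.blockVariance_le hb hf hℓ).trans ?_
  set B : ℝ := (b : ℝ) with hBdef
  have hB2 : (2 : ℝ) ≤ B := by rw [hBdef]; exact_mod_cast hb
  have hB0 : 0 < B := by linarith
  have hB1 : 0 < B - 1 := by linarith
  set q : ℝ := B ^ (-α) with hqdef
  have hq0 : 0 < q := Real.rpow_pos_of_pos hB0 _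
  set u : ℝ := (B - 1) / B with hudef
  have hu0 : 0 < u := div_pos hB1 hB0
  have hu1 : u ≤ 1 := (div_le_one hB0).2 (by linarith)
  -- `u² ≤ (B - 1) u^{2α}`
  have hkey : u ^ 2 ≤ (B - 1) * u ^ (2 * α) := by
    have h1 : u ^ 2 ≤ u ^ (2 * α) := by
      rw [show u ^ 2 = u ^ ((2 : ℕ) : ℝ) from (Real.rpow_natCast u 2).symm]
      push_cast
      exact Real.rpow_le_rpow_of_exponent_ge hu0 hu1 (by linarith)
    calc u ^ 2 ≤ u ^ (2 * α) := h1
      _ = 1 * u ^ (2 * α) := (one_mul _).symm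
      _ ≤ (B - 1) * u ^ (2 * α) := mul_le_mul_of_nonneg_right (by linarith) (by positivity)
  -- rewrite the right-hand side in terms of `u` and `q`
  have h1 : (B - 1) ^ (1 + 2 * α) = (B - 1) * (B - 1) ^ (2 * α) := by
    rw [Real.rpow_add hB1, Real.rpow_one]
  have h2 : B ^ (-(2 * α * ℓ)) = q ^ (2 * (ℓ - 1)) * q ^ 2 := by
    rw [← pow_add, show 2 * (ℓ - 1) + 2 = 2 * ℓ by omega, hqdef, ← Real.rpow_natCast,
      ← Real.rpow_mul hB0.le]
    push_cast
    ring_nf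
  have h3 : (B - 1) ^ (2 * α) * q ^ 2 = u ^ (2 * α) := by
    rw [hudef, Real.div_rpow hB1.le hB0.le, hqdef, ← Real.rpow_natCast, ← Real.rpow_mul hB0.le,
      show -α * ((2 : ℕ) : ℝ) = -(2 * α) by push_cast; ring, Real.rpow_neg hB0.le, div_eq_mul_inv]
  have hQ : 0 ≤ C ^ 2 * (q ^ (ℓ - 1)) ^ 2 := by positivity
  calc (u * (C * q ^ (ℓ - 1))) ^ 2 = C ^ 2 * (q ^ (ℓ - 1)) ^ 2 * u ^ 2 := by ring
    _ ≤ C ^ 2 * (q ^ (ℓ - 1)) ^ 2 * ((B - 1) * u ^ (2 * α)) :=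
        mul_le_mul_of_nonneg_left hkey hQ
    _ = C ^ 2 * (B - 1) ^ (1 + 2 * α) * B ^ (-(2 * α * ℓ)) := by
        rw [h1, h2, ← h3]; ring

/-- A digit-Hölder function keeps its Hölder data after truncation of the argument to `L` digits.
[folklore] -/
private theorem comp_truncateDigits (hF : DigitHolderWith b C q f) (L : ℕ) :
    DigitHolderWith b C q (fun ζ => f (truncateDigits b L ζ)) := by
  intro w ζ ζ' h
  refine hF w _ _ (funext fun i => ?_)
  have hi := congrFun h i
  simp only [digitsPrefix] at hi ⊢
  by_cases hiL : (i : ℕ) < L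
  · simp [truncateDigits, hiL, hi]
  · simp [truncateDigits, hiL]

end DigitHolderWith

/-- **Hölder on `[0,1]` ⇒ digit-Hölder with ratio `b^{-α}`**: if `|F(x) - F(y)| ≤ C |x - y|^α` for
`x, y ∈ [0,1]` (`C ≥ 0`, `α ≥ 0`), then `F ∘ (x = Σ_i ζ_i b^{-i})` satisfies
`|f(ζ) - f(ζ')| ≤ C b^{-αw}` whenever `ζ, ζ'` share `w` digits (two points of an elementary
interval of order `w` are within `b^{-w}`, `Real.abs_ofDigits_sub_ofDigits_le`).
[cite: DickPillichshammer2010, Cor. 13.21] (hypothesis, p. 425: "`|f(x + h) - f(x)| ≤ C_f h^α`") -/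
theorem DigitHolderWith.comp_ofDigits [NeZero b] {F : ℝ → ℂ} {C α : ℝ} (hC : 0 ≤ C) (hα : 0 ≤ α)
    (hF : ∀ x ∈ Set.Icc (0 : ℝ) 1, ∀ y ∈ Set.Icc (0 : ℝ) 1, ‖F x - F y‖ ≤ C * |x - y| ^ α) :
    DigitHolderWith b C ((b : ℝ) ^ (-α)) (fun ζ => F (Real.ofDigits ζ)) := by
  intro w ζ ζ' h
  have hB0 : (0 : ℝ) ≤ b := Nat.cast_nonneg b
  have hx : Real.ofDigits ζ ∈ Set.Icc (0 : ℝ) 1 := ⟨Real.ofDigits_nonneg _, Real.ofDigits_le_one _⟩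
  have hy : Real.ofDigits ζ' ∈ Set.Icc (0 : ℝ) 1 :=
    ⟨Real.ofDigits_nonneg _, Real.ofDigits_le_one _⟩
  have hdist : |Real.ofDigits ζ - Real.ofDigits ζ'| ≤ ((b : ℝ) ^ w)⁻¹ :=
    Real.abs_ofDigits_sub_ofDigits_le fun i hi => congrFun h ⟨i, hi⟩
  have hpow : |Real.ofDigits ζ - Real.ofDigits ζ'| ^ α ≤ ((b : ℝ) ^ (-α)) ^ w := by
    refine (Real.rpow_le_rpow (abs_nonneg _) hdist hα).trans_eq ?_
    rw [← Real.rpow_natCast, ← Real.rpow_natCast, Real.inv_rpow (by positivity),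
      ← Real.rpow_neg (by positivity), ← Real.rpow_mul hB0, ← Real.rpow_mul hB0, mul_comm]
  exact (hF _ hx _ hy).trans (mul_le_mul_of_nonneg_left hpow hC)

/-- The geometric tail `Σ_{n < ℓ ≤ L} r^ℓ ≤ r^{n+1}/(1-r)` for `0 ≤ r < 1`. [folklore] -/
private theorem sum_Ioc_pow_le {r : ℝ} (hr0 : 0 ≤ r) (hr1 : r < 1) (n L : ℕ) :
    ∑ ℓ ∈ Ioc n L, r ^ ℓ ≤ r ^ (n + 1) / (1 - r) := by
  have hI : Ioc n L = Ico (n + 1) (L + 1) := by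
    ext ℓ
    simp only [mem_Ioc, mem_Ico]
    omega
  rw [hI]
  exact geom_sum_Ico_le_of_lt_one hr0 hr1

/-- **Theorem 13.22** [cite: DickPillichshammer2010, Thm. 13.22]: let `f` satisfy a Hölder
condition of order `0 < α ≤ 1` with constant `C_f` (digit-Hölder with ratio `b^{-α}`) and depend on
finitely many digits (precision `L`, e.g. the integrand evaluated at points truncated to `L ≥ m`
digits — the bound does not depend on `L`). Then the randomised QMC estimator `Î(f)` based on a
scrambled `(t, m, 1)`-net in base `b` satisfies
`Var[Î(f)] = E|Î(f) - ∫ f|² ≤ b^{-(1+2α)(m-t)} C_f² (b-1)^{1+2α}/(b^{2α} - 1)`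
(so `√Var ≈ N^{-(1+2α)/2}`, `N = b^m`; `O(N^{-3/2})` for Lipschitz `f`). From Theorem 13.5
(`IsDigitNet.integral_norm_sq_scrambledAverage_sub_le`) and Corollary 13.21. -/
theorem IsDigitNet.integral_norm_sq_scrambledAverage_sub_le_of_holder [NeZero b] (hb : 1 < b)
    {κ : Type*} [Fintype κ] {t m : ℕ} {ξ : κ → ℕ → Fin b} (h : IsDigitNet b t m ξ)
    {f : (ℕ → Fin b) → ℂ} {L : ℕ} (hfL : DependsOnDigits b L f) {C α : ℝ} (hα₀ : 0 < α)
    (hα₁ : α ≤ 1) (hF : DigitHolderWith b C ((b : ℝ) ^ (-α)) f) :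
    ∫ π, ‖scrambledAverage b π ξ f - ∫ η, f η ∂digitSeqMeasure b‖ ^ 2 ∂scrambleMeasure b ≤
      (b : ℝ) ^ (-((1 + 2 * α) * (m - t : ℕ))) *
        (C ^ 2 * ((b : ℝ) - 1) ^ (1 + 2 * α) / ((b : ℝ) ^ (2 * α) - 1)) := by
  set B : ℝ := (b : ℝ) with hBdef
  have hB1 : (1 : ℝ) < B := by rw [hBdef]; exact_mod_cast hb
  have hB0 : 0 < B := by linarith
  have htm : t ≤ m := h.1
  set n := m - t with hn
  -- the Walsh polynomial `f = Σ_{k < b^L} f̂(k) wal_k` and Theorem 13.5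
  have hfW : f = walshPoly b L (walshCoeffD b f) :=
    funext fun η => (hfL.walshPoly_walshCoeffD hb η).symm
  have h135 := h.integral_norm_sq_scrambledAverage_sub_le hb L (walshCoeffD b f)
  rw [← hfW, walshCoeffD_zero_eq_integral] at h135
  refine h135.trans ?_
  -- Corollary 13.21 summed over `m - t < ℓ ≤ L`
  set K : ℝ := C ^ 2 * (B - 1) ^ (1 + 2 * α) with hK
  set P : ℝ := B ^ (2 * α) with hP
  have hP1 : 1 < P := Real.one_lt_rpow hB1 (by linarith)
  have hP0 : 0 < P := by linarith
  set r : ℝ := P⁻¹ with hr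
  have hr0 : 0 ≤ r := by positivity
  have hr1 : r < 1 := inv_lt_one_of_one_lt₀ hP1
  have hrpow : ∀ ℓ : ℕ, B ^ (-(2 * α * ℓ)) = r ^ ℓ := by
    intro ℓ
    rw [hr, hP, inv_pow, ← Real.rpow_natCast, ← Real.rpow_mul hB0.le, ← Real.rpow_neg hB0.le]
  have hσ : ∀ ℓ ∈ Ioc n L, blockVariance b (walshCoeffD b f) ℓ ≤ K * r ^ ℓ := by
    intro ℓ hℓ
    rw [← hrpow]
    exact hF.blockVariance_le_rpow hb hα₁ hfL.integrable (Nat.one_le_of_lt (mem_Ioc.1 hℓ).1)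
  have hsum : ∑ ℓ ∈ Ioc n L, blockVariance b (walshCoeffD b f) ℓ ≤ K * (r ^ (n + 1) / (1 - r)) :=
    calc ∑ ℓ ∈ Ioc n L, blockVariance b (walshCoeffD b f) ℓ ≤ ∑ ℓ ∈ Ioc n L, K * r ^ ℓ :=
          sum_le_sum hσ
      _ = K * ∑ ℓ ∈ Ioc n L, r ^ ℓ := (mul_sum _ _ _).symm
      _ ≤ K * (r ^ (n + 1) / (1 - r)) :=
          mul_le_mul_of_nonneg_left (sum_Ioc_pow_le hr0 hr1 n L) (by positivity)
  -- the prefactor `b^t/b^m = b^{-(m-t)}`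
  have hpre : B ^ t / B ^ m = (B ^ n)⁻¹ := by
    rw [show m = n + t by omega, pow_add]
    field_simp
  have hfin : (B ^ n)⁻¹ * (K * (r ^ (n + 1) / (1 - r))) =
      B ^ (-((1 + 2 * α) * n)) * (K / (P - 1)) := by
    have hBn : B ^ (-((1 + 2 * α) * n)) = (B ^ n)⁻¹ * r ^ n := by
      rw [Real.rpow_neg hB0.le, Real.rpow_mul hB0.le, Real.rpow_natCast, Real.rpow_add hB0,
        Real.rpow_one, mul_pow, mul_inv, hr, inv_pow]
    have hP1' : P - 1 ≠ 0 := by linarith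
    rw [hBn, pow_succ, hr]
    field_simp
  calc B ^ t / B ^ m * ∑ ℓ ∈ Ioc n L, blockVariance b (walshCoeffD b f) ℓ
      ≤ B ^ t / B ^ m * (K * (r ^ (n + 1) / (1 - r))) :=
        mul_le_mul_of_nonneg_left hsum (by positivity)
    _ = B ^ (-((1 + 2 * α) * n)) * (K / (P - 1)) := by rw [hpre, hfin]

/-- **Theorem 13.22 for a Hölder integrand on `[0,1]` evaluated in finite precision**
[cite: DickPillichshammer2010, Thm. 13.22]: let `F` satisfy `|F(x) - F(y)| ≤ C |x - y|^α` on
`[0,1]` (`0 < α ≤ 1`, `C ≥ 0`) and let `f_L(ζ) = F(Σ_{i<L} ζ_i b^{-i-1})` be `F` at the point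
truncated to `L` digits, `L` arbitrary (e.g. `L ≥ m`: the estimator computed in `L`-digit
arithmetic). Then for a scrambled `(t, m, 1)`-net in base `b`,
`E|Î(f_L) - ∫ f_L|² ≤ b^{-(1+2α)(m-t)} C² (b-1)^{1+2α} / (b^{2α} - 1)`, uniformly in `L`. -/
theorem IsDigitNet.integral_norm_sq_scrambledAverage_sub_le_of_holder_ofDigits [NeZero b]
    (hb : 1 < b) {κ : Type*} [Fintype κ] {t m : ℕ} {ξ : κ → ℕ → Fin b} (h : IsDigitNet b t m ξ)
    {F : ℝ → ℂ} {C α : ℝ} (hC : 0 ≤ C) (hα₀ : 0 < α) (hα₁ : α ≤ 1)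
    (hF : ∀ x ∈ Set.Icc (0 : ℝ) 1, ∀ y ∈ Set.Icc (0 : ℝ) 1, ‖F x - F y‖ ≤ C * |x - y| ^ α)
    (L : ℕ) :
    ∫ π, ‖scrambledAverage b π ξ (fun ζ => F (Real.ofDigits (truncateDigits b L ζ))) -
        ∫ η, F (Real.ofDigits (truncateDigits b L η)) ∂digitSeqMeasure b‖ ^ 2
        ∂scrambleMeasure b ≤
      (b : ℝ) ^ (-((1 + 2 * α) * (m - t : ℕ))) *
        (C ^ 2 * ((b : ℝ) - 1) ^ (1 + 2 * α) / ((b : ℝ) ^ (2 * α) - 1)) :=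
  h.integral_norm_sq_scrambledAverage_sub_le_of_holder hb
    (dependsOnDigits_comp_truncateDigits L fun ζ => F (Real.ofDigits ζ)) hα₀ hα₁
    ((DigitHolderWith.comp_ofDigits hC hα₀.le hF).comp_truncateDigits L)

/-! ### Lemma 13.24 and the summation step of Theorem 13.25 -/

/-- Submultiplicativity of the stars-and-bars numbers:
`binom(a+c+k, k) ≤ binom(a+k, k) binom(c+k, k)`. [folklore] -/
private theorem choose_add_le_mul_choose (k c : ℕ) :
    ∀ a : ℕ, (a + c + k).choose k ≤ (a + k).choose k * (c + k).choose k
  | 0 => by simp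
  | a + 1 => by
    have ih := choose_add_le_mul_choose k c a
    have h1 : (a + 1 + c + k).choose k * (a + c + 1) = (a + c + k).choose k * (a + c + k + 1) := by
      have e1 : a + 1 + c + k = a + c + k + 1 := by omega
      have e2 : a + c + k + 1 - k = a + c + 1 := by omega
      rw [e1, ← e2]
      exact (Nat.choose_mul_succ_eq _ _).symm
    have h2 : (a + 1 + k).choose k * (a + 1) = (a + k).choose k * (a + k + 1) := by
      have e1 : a + 1 + k = a + k + 1 := by omega
      have e2 : a + k + 1 - k = a + 1 := by omega
      rw [e1, ← e2]
      exact (Nat.choose_mul_succ_eq _ _).symm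
    have hineq : (a + c + k + 1) * (a + 1) ≤ (a + k + 1) * (a + c + 1) := by nlinarith
    refine Nat.le_of_mul_le_mul_right (c := (a + c + 1) * (a + 1)) ?_ (by positivity)
    calc (a + 1 + c + k).choose k * ((a + c + 1) * (a + 1))
        = (a + c + k).choose k * (a + c + k + 1) * (a + 1) := by rw [← mul_assoc, h1]
      _ ≤ (a + k).choose k * (c + k).choose k * (a + c + k + 1) * (a + 1) :=
          Nat.mul_le_mul_right _ (Nat.mul_le_mul_right _ ih)
      _ = (a + k).choose k * (c + k).choose k * ((a + c + k + 1) * (a + 1)) := by ring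
      _ ≤ (a + k).choose k * (c + k).choose k * ((a + k + 1) * (a + c + 1)) :=
          Nat.mul_le_mul_left _ hineq
      _ = (a + k).choose k * (a + k + 1) * ((c + k).choose k * (a + c + 1)) := by ring
      _ = (a + 1 + k).choose k * (a + 1) * ((c + k).choose k * (a + c + 1)) := by rw [h2]
      _ = (a + 1 + k).choose k * (c + k).choose k * ((a + c + 1) * (a + 1)) := by ring

/-- **Lemma 13.24**, partial sums [cite: DickPillichshammer2010, Lemma 13.24]: for `0 ≤ β < 1`
and `k, t₀ ∈ ℕ`, `Σ_{j < J} β^{t₀+j} binom(t₀+j+k, k) ≤ β^{t₀} binom(t₀+k, k) / (1-β)^{k+1}`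
(the book's `k` is our `k + 1`, its `b^{-1}` our `β`). Proof as in the book: `binom(t₀+j+k, k) ≤
binom(t₀+k, k) binom(j+k, k)` and `Σ_j binom(j+k, k) β^j = (1-β)^{-k-1}`. -/
theorem sum_pow_mul_choose_le {β : ℝ} (hβ0 : 0 ≤ β) (hβ1 : β < 1) (k t₀ J : ℕ) :
    ∑ j ∈ range J, β ^ (t₀ + j) * ((t₀ + j + k).choose k : ℝ) ≤
      β ^ t₀ * ((t₀ + k).choose k : ℝ) / (1 - β) ^ (k + 1) := by
  have hgeo := hasSum_choose_mul_geometric_of_norm_lt_one k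
    (show ‖β‖ < 1 by rwa [Real.norm_of_nonneg hβ0])
  have hle : ∀ j, β ^ (t₀ + j) * ((t₀ + j + k).choose k : ℝ) ≤
      β ^ t₀ * ((t₀ + k).choose k : ℝ) * (((j + k).choose k : ℝ) * β ^ j) := by
    intro j
    have hc : ((t₀ + j + k).choose k : ℝ) ≤ ((t₀ + k).choose k : ℝ) * ((j + k).choose k : ℝ) := by
      exact_mod_cast choose_add_le_mul_choose k j t₀
    calc β ^ (t₀ + j) * ((t₀ + j + k).choose k : ℝ)
        ≤ β ^ (t₀ + j) * (((t₀ + k).choose k : ℝ) * ((j + k).choose k : ℝ)) :=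
          mul_le_mul_of_nonneg_left hc (by positivity)
      _ = β ^ t₀ * ((t₀ + k).choose k : ℝ) * (((j + k).choose k : ℝ) * β ^ j) := by
          rw [pow_add]; ring
  calc ∑ j ∈ range J, β ^ (t₀ + j) * ((t₀ + j + k).choose k : ℝ)
      ≤ ∑ j ∈ range J, β ^ t₀ * ((t₀ + k).choose k : ℝ) * (((j + k).choose k : ℝ) * β ^ j) :=
        sum_le_sum fun j _ => hle j
    _ = β ^ t₀ * ((t₀ + k).choose k : ℝ) * ∑ j ∈ range J, ((j + k).choose k : ℝ) * β ^ j :=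
        (mul_sum _ _ _).symm
    _ ≤ β ^ t₀ * ((t₀ + k).choose k : ℝ) * (1 / (1 - β) ^ (k + 1)) :=
        mul_le_mul_of_nonneg_left (sum_le_hasSum _ (fun j _ => by positivity) hgeo)
          (by positivity)
    _ = β ^ t₀ * ((t₀ + k).choose k : ℝ) / (1 - β) ^ (k + 1) := by ring

/-- **Lemma 13.24** [cite: DickPillichshammer2010, Lemma 13.24]: for real `b > 1` and
`k, t₀ ∈ ℕ`, `Σ_{t ≥ t₀} b^{-t} binom(t+k, k) ≤ b^{-t₀} binom(t₀+k, k) (1 - 1/b)^{-(k+1)}` (the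
book's `k` is our `k + 1`; the sum is indexed by `t = t₀ + j`). -/
theorem tsum_pow_mul_choose_le {B : ℝ} (hB : 1 < B) (k t₀ : ℕ) :
    ∑' j : ℕ, B⁻¹ ^ (t₀ + j) * ((t₀ + j + k).choose k : ℝ) ≤
      B⁻¹ ^ t₀ * ((t₀ + k).choose k : ℝ) / (1 - B⁻¹) ^ (k + 1) :=
  have hB0 : 0 ≤ B⁻¹ := inv_nonneg.2 (by linarith)
  Real.tsum_le_of_sum_range_le (fun _ => mul_nonneg (pow_nonneg hB0 _) (Nat.cast_nonneg _))
    fun J => sum_pow_mul_choose_le hB0 (inv_lt_one_of_one_lt₀ hB) k t₀ J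

/-- **Stars and bars**: among any digit-length vectors `𝓵 ∈ ℕ₀^s`, at most `binom(n+s-1, s-1)`
have `|𝓵|₁ = n`. [folklore] (used in the proof of [cite: DickPillichshammer2010, Thm. 13.25]:
"`Σ_{|𝓵|₁ = l} 1 = binom(l+s-1, s-1)`") -/
theorem card_filter_sum_eq_le {ι : Type*} [Fintype ι] (T : Finset (ι → ℕ)) (n : ℕ) :
    (T.filter fun ℓ => ∑ j, ℓ j = n).card ≤
      (n + (Fintype.card ι - 1)).choose (Fintype.card ι - 1) := by
  classical
  rcases isEmpty_or_nonempty ι with hι | hι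
  · calc (T.filter fun ℓ => ∑ j, ℓ j = n).card ≤ 1 :=
          Finset.card_le_one.2 fun x _ y _ => funext fun i => isEmptyElim i
      _ ≤ (n + (Fintype.card ι - 1)).choose (Fintype.card ι - 1) := Nat.choose_pos (by omega)
  · set s := Fintype.card ι with hs
    have hs1 : s - 1 + 1 = s := Nat.sub_add_cancel Fintype.card_pos
    let e : ι ≃ Fin (s - 1 + 1) := (Fintype.equivFin ι).trans (finCongr hs1.symm)
    refine (Finset.card_le_card_of_injOn (fun ℓ : ι → ℕ => ℓ ∘ e.symm) (fun ℓ hℓ => ?_)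
      (fun ℓ _ ℓ' _ h => ?_)).trans_eq
      (Literature.Combinatorics.Enumerative.card_antidiagonalTuple_succ (s - 1) n)
    · rw [Finset.mem_coe, Finset.Nat.mem_antidiagonalTuple, ← (Finset.mem_filter.1 hℓ).2]
      exact e.symm.sum_comp ℓ
    · funext j
      simpa using congrFun h (e j)

/-- **The summation step of Theorem 13.25** [cite: DickPillichshammer2010, Thm. 13.25] (proof,
p. 430–431), in general geometric form: if the nested ANOVA variances of the coefficient family
`c` decay like `σ_𝓵² ≤ K β^{|𝓵|₁}` for `𝓵 ≠ 0` (`K ≥ 0`, `0 ≤ β < 1`; in the book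
`K = (b-1)^{(2α-1)₊ s} V_α(f)²`, `β = b^{-2α}` by Lemma 13.23), then for every `n`
`Σ_{𝓵 ∈ [0,L]^s, 𝓵 ≠ 0, |𝓵|₁ > n} σ_𝓵² ≤ K Σ_{l > n} β^l binom(l+s-1, s-1)
  ≤ K β^{n+1} binom(n+s, s-1) / (1-β)^s` (stars and bars and Lemma 13.24). -/
theorem sum_blockVariancePi_le_of_decay [NeZero b] {ι : Type*} [Fintype ι] [DecidableEq ι]
    {c : (ι → ℕ) → ℂ} {K β : ℝ} (hK : 0 ≤ K) (hβ0 : 0 ≤ β) (hβ1 : β < 1)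
    (hσ : ∀ ℓ : ι → ℕ, ℓ ≠ 0 → blockVariancePi b c ℓ ≤ K * β ^ (∑ j, ℓ j)) (n L : ℕ) :
    ∑ ℓ ∈ ((Fintype.piFinset fun _ : ι => range (L + 1)).erase 0).filter (fun ℓ => n < ∑ j, ℓ j),
        blockVariancePi b c ℓ ≤
      K * (β ^ (n + 1) * ((n + Fintype.card ι).choose (Fintype.card ι - 1) : ℝ) /
        (1 - β) ^ Fintype.card ι) := by
  classical
  have h1β : 0 < 1 - β := sub_pos.2 hβ1
  set s := Fintype.card ι with hs
  set E := ((Fintype.piFinset fun _ : ι => range (L + 1)).erase 0).filter (fun ℓ => n < ∑ j, ℓ j)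
    with hE
  rcases isEmpty_or_nonempty ι with hι | hι
  · have hE0 : ∀ ℓ ∈ E, False := by
      intro ℓ hℓ
      have h := (Finset.mem_filter.1 hℓ).2
      rw [Finset.univ_eq_empty, Finset.sum_empty] at h
      exact Nat.not_lt_zero _ h
    calc ∑ ℓ ∈ E, blockVariancePi b c ℓ = 0 := sum_eq_zero fun ℓ hℓ => (hE0 ℓ hℓ).elim
      _ ≤ _ := mul_nonneg hK (div_nonneg (by positivity) (pow_nonneg h1β.le _))
  have hs1 : s - 1 + 1 = s := Nat.sub_add_cancel Fintype.card_pos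
  -- step 1: the decay hypothesis
  have h1 : ∑ ℓ ∈ E, blockVariancePi b c ℓ ≤ K * ∑ ℓ ∈ E, β ^ (∑ j, ℓ j) := by
    rw [mul_sum]
    exact sum_le_sum fun ℓ hℓ => hσ ℓ (Finset.mem_erase.1 (Finset.mem_filter.1 hℓ).1).1
  -- step 2: group the digit-length vectors by `|𝓵|₁ = v`, `n < v ≤ sL`
  have h2 : ∑ ℓ ∈ E, β ^ (∑ j, ℓ j) =
      ∑ v ∈ E.image (fun ℓ => ∑ j, ℓ j), ((E.filter fun ℓ => ∑ j, ℓ j = v).card : ℝ) * β ^ v := by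
    rw [Finset.sum_comp (fun v => β ^ v) (fun ℓ : ι → ℕ => ∑ j, ℓ j)]
    simp only [nsmul_eq_mul]
  have hsub : E.image (fun ℓ => ∑ j, ℓ j) ⊆ Ico (n + 1) (n + 1 + (s * L + 1)) := by
    intro v hv
    obtain ⟨ℓ, hℓ, rfl⟩ := Finset.mem_image.1 hv
    have hℓ' := Finset.mem_filter.1 hℓ
    have hbox := Fintype.mem_piFinset.1 (Finset.mem_erase.1 hℓ'.1).2
    have hle : ∑ j, ℓ j ≤ s * L :=
      calc ∑ j, ℓ j ≤ ∑ _j : ι, L := sum_le_sum fun j _ => Nat.lt_succ_iff.1 (mem_range.1 (hbox j))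
        _ = s * L := by rw [sum_const, card_univ, smul_eq_mul]
    rw [mem_Ico]
    omega
  have h3 : ∑ v ∈ E.image (fun ℓ => ∑ j, ℓ j), ((E.filter fun ℓ => ∑ j, ℓ j = v).card : ℝ) * β ^ v
      ≤ ∑ v ∈ Ico (n + 1) (n + 1 + (s * L + 1)), ((v + (s - 1)).choose (s - 1) : ℝ) * β ^ v :=
    calc ∑ v ∈ E.image (fun ℓ => ∑ j, ℓ j), ((E.filter fun ℓ => ∑ j, ℓ j = v).card : ℝ) * β ^ v
        ≤ ∑ v ∈ E.image (fun ℓ => ∑ j, ℓ j), ((v + (s - 1)).choose (s - 1) : ℝ) * β ^ v :=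
          sum_le_sum fun v _ => mul_le_mul_of_nonneg_right
            (by exact_mod_cast card_filter_sum_eq_le E v) (by positivity)
      _ ≤ ∑ v ∈ Ico (n + 1) (n + 1 + (s * L + 1)), ((v + (s - 1)).choose (s - 1) : ℝ) * β ^ v :=
          sum_le_sum_of_subset_of_nonneg hsub fun v _ _ => by positivity
  -- step 3: Lemma 13.24
  have h4 := sum_pow_mul_choose_le hβ0 hβ1 (s - 1) (n + 1) (s * L + 1)
  rw [hs1, show n + 1 + (s - 1) = n + s by omega] at h4
  have h5 : ∑ v ∈ Ico (n + 1) (n + 1 + (s * L + 1)), ((v + (s - 1)).choose (s - 1) : ℝ) * β ^ v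
      = ∑ j ∈ range (s * L + 1), β ^ (n + 1 + j) * ((n + 1 + j + (s - 1)).choose (s - 1) : ℝ) := by
    rw [Finset.sum_Ico_eq_sum_range, show n + 1 + (s * L + 1) - (n + 1) = s * L + 1 by omega]
    exact sum_congr rfl fun j _ => mul_comm _ _
  calc ∑ ℓ ∈ E, blockVariancePi b c ℓ ≤ K * ∑ ℓ ∈ E, β ^ (∑ j, ℓ j) := h1
    _ ≤ K * (β ^ (n + 1) * ((n + s).choose (s - 1) : ℝ) / (1 - β) ^ s) := by
        refine mul_le_mul_of_nonneg_left ?_ hK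
        rw [h2]
        exact h3.trans (h5.trans_le h4)

/-- **Theorem 13.25**, summation half, for scrambled digital `(t, m, s)`-nets
[cite: DickPillichshammer2010, Thm. 13.25]: if the nested ANOVA variances of the Walsh polynomial
`f = Σ c_𝐤 wal_𝐤` decay like `σ_𝓵²(f) ≤ K β^{|𝓵|₁}` (`𝓵 ≠ 0`; the book: `K = (b-1)^{(2α-1)₊ s}
V_α(f)²`, `β = b^{-2α}`, from a bounded generalised variation of order `0 < α ≤ 1` via
Lemma 13.23 — taken as a hypothesis here), then by Theorem 13.9
(`IsDigitalTMSNet.integral_norm_sq_scrambledAveragePi_sub_le`) and Lemma 13.24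
`Var[Î(f)] ≤ b^{t+s-m} K β^{m-t+1} binom(m-t+s, s-1) / (1-β)^s`; for `β = b^{-2α}` this is
`K b^{-(1+2α)(m-t)} · b^{s-2α} (1-b^{-2α})^{-s} binom(m-t+s, s-1)`, i.e.
`√Var = O(N^{-α-1/2} (log N)^{(s-1)/2})` [Remark 13.26], and for `α ≥ 1/2` it is at most the
displayed `V_α² b^{-(1+2α)(m-t)} (b-1)^{(2α-1)₊ s} b^{2s} / (b^{2α} (b-1)^s) binom(m-t+s, s-1)` (see
the module docstring, note 3). -/
theorem IsDigitalTMSNet.integral_norm_sq_scrambledAveragePi_sub_le_of_decay [NeZero b]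
    (hb : 1 < b) {ι : Type*} [Fintype ι] [DecidableEq ι] {m p t : ℕ}
    {C : ι → Matrix (Fin p) (Fin m) (ZMod b)} (hC : IsDigitalTMSNet t C) (L : ℕ)
    (c : (ι → ℕ) → ℂ) {K β : ℝ} (hK : 0 ≤ K) (hβ0 : 0 ≤ β) (hβ1 : β < 1)
    (hσ : ∀ ℓ : ι → ℕ, ℓ ≠ 0 → blockVariancePi b c ℓ ≤ K * β ^ (∑ j, ℓ j)) :
    ∫ π, ‖scrambledAveragePi b π (digitalNetDigits C) (walshPolyPi b L c) - c 0‖ ^ 2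
        ∂scrambleMeasurePi b ι ≤
      (b : ℝ) ^ t * (b : ℝ) ^ Fintype.card ι / (b : ℝ) ^ m *
        (K * (β ^ (m - t + 1) * ((m - t + Fintype.card ι).choose (Fintype.card ι - 1) : ℝ) /
          (1 - β) ^ Fintype.card ι)) :=
  (hC.integral_norm_sq_scrambledAveragePi_sub_le hb L c).trans
    (mul_le_mul_of_nonneg_left (sum_blockVariancePi_le_of_decay hK hβ0 hβ1 hσ (m - t) L)
      (by positivity))

/-- **Theorem 13.25**, summation half, for arbitrary scrambled `(t, m, s)`-nets
[cite: DickPillichshammer2010, Thm. 13.25] (with Theorem 13.6 and Owen's gain bound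
`Γ_𝓵 ≤ b^t ((b+1)/(b-1))^s`, `IsDigitNetPi.gainFactorPi_le_card_mul`, in place of Theorem 13.9;
[cite: Owen1998, Thm. 1]): under `σ_𝓵²(f) ≤ K β^{|𝓵|₁}` (`𝓵 ≠ 0`),
`Var[Î(f)] ≤ (b^t/b^m) ((b+1)/(b-1))^s K β^{m-t+1} binom(m-t+s, s-1) / (1-β)^s`. -/
theorem IsDigitNetPi.integral_norm_sq_scrambledAveragePi_sub_le_of_decay [NeZero b] (hb : 1 < b)
    {ι : Type*} [Fintype ι] [DecidableEq ι] {κ : Type*} [Fintype κ] {t m : ℕ}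
    {ξ : κ → ι → ℕ → Fin b} (h : IsDigitNetPi b t m ξ) (L : ℕ) (c : (ι → ℕ) → ℂ) {K β : ℝ}
    (hK : 0 ≤ K) (hβ0 : 0 ≤ β) (hβ1 : β < 1)
    (hσ : ∀ ℓ : ι → ℕ, ℓ ≠ 0 → blockVariancePi b c ℓ ≤ K * β ^ (∑ j, ℓ j)) :
    ∫ π, ‖scrambledAveragePi b π ξ (walshPolyPi b L c) - c 0‖ ^ 2 ∂scrambleMeasurePi b ι ≤
      (b : ℝ) ^ t / (b : ℝ) ^ m * (((b : ℝ) + 1) / ((b : ℝ) - 1)) ^ Fintype.card ι *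
        (K * (β ^ (m - t + 1) * ((m - t + Fintype.card ι).choose (Fintype.card ι - 1) : ℝ) /
          (1 - β) ^ Fintype.card ι)) := by
  have hb1 : (1 : ℝ) < b := by exact_mod_cast hb
  have hbm1 : (b : ℝ) - 1 ≠ 0 := by linarith
  have hR : 0 < ((b : ℝ) + 1) / ((b : ℝ) - 1) := div_pos (by linarith) (by linarith)
  have hB : (b : ℝ) ^ m ≠ 0 := pow_ne_zero _ (by exact_mod_cast (NeZero.ne b))
  set E := ((Fintype.piFinset fun _ : ι => range (L + 1)).erase 0).filter
    (fun ℓ => m - t < ∑ i, ℓ i) with hE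
  have hV : ∀ ℓ, 0 ≤ blockVariancePi b c ℓ := fun ℓ => sum_nonneg fun _ _ => sq_nonneg _
  rw [h.integral_norm_sq_scrambledAveragePi_sub_eq hb L c, h.2.1]
  push_cast
  calc (((b : ℝ) ^ m) ^ 2)⁻¹ * ∑ ℓ ∈ E, gainFactorPi b ℓ ξ * blockVariancePi b c ℓ
      ≤ (((b : ℝ) ^ m) ^ 2)⁻¹ * ∑ ℓ ∈ E,
          ((b : ℝ) ^ m * (b : ℝ) ^ t * (((b : ℝ) + 1) / ((b : ℝ) - 1)) ^ Fintype.card ι) *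
            blockVariancePi b c ℓ := by
        refine mul_le_mul_of_nonneg_left (sum_le_sum fun ℓ hℓ =>
          mul_le_mul_of_nonneg_right ?_ (hV ℓ)) (by positivity)
        have hΓ := h.gainFactorPi_le_card_mul hb (Finset.mem_erase.1 (Finset.mem_filter.1 hℓ).1).1
        rw [h.2.1] at hΓ
        exact_mod_cast hΓ
    _ = (b : ℝ) ^ t / (b : ℝ) ^ m * (((b : ℝ) + 1) / ((b : ℝ) - 1)) ^ Fintype.card ι *
          ∑ ℓ ∈ E, blockVariancePi b c ℓ := by
        rw [← Finset.mul_sum, ← mul_assoc]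
        congr 1
        field_simp
    _ ≤ _ :=
        mul_le_mul_of_nonneg_left (sum_blockVariancePi_le_of_decay hK hβ0 hβ1 hσ (m - t) L)
          (by positivity)

end Literature.Analysis.Quadrature

end
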